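import Literature.AnabelianGeometry.EtaleTheta.Discharge.Sec3Thm37
import Literature.AnabelianGeometry.EtaleTheta.TemperedFrobenioidProps
import HarnessLib

/-!
# [EtTh] Theorem 3.7 (iv) — bridge to L2-t3's named `Prop` `Thm37_iv`

Proof-only sequel of `Discharge/Sec3Thm37.lean` (S. Mochizuki, [EtTh] Thm 3.7 (iv) p. 80 = PDF p. 306 of
`paper:doi-10-2977-prims-1234361159`): the named statement `TemperedFrobenioid.Thm37_iv` of
`TemperedFrobenioidProps.lean` ("If `D` is slim, and `Λ ∈ {ℤ, ℝ}`, then `C` is also slim") follows from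
`TemperedFrobenioid.isSlim_category_of` under the same four inputs (`hF` [FrdI] Thm 5.2 (ii), `hB`
group-like `B₀^Λ`, `hqft` quasi-Frobenius-trivial type, `hdiv` `⋂ₙ O^×(A)ⁿ = 1`).  Separate file only
because the two parents build at different times.  Nothing here bears on [IUTchIII] Cor. 3.12.
-/

namespace Literature.AnabelianGeometry.EtaleTheta

open CategoryTheory Opposite Literature.AlgebraicGeometry.Frobenioids

universe u₀ v₀ u v w

variable {D₀ : Type u₀} [Category.{v₀} D₀] {V : FrdIMonoidStub.{w}}
  {T : RealifiedDivisorMonoids (D₀ := D₀) V} {D : Type u} [Category.{v} D] {VD : FrdICatStub.{u, v, w} D}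

namespace TemperedFrobenioid

variable (C₀ : TemperedFrobenioid T D VD)

/-- **Thm 3.7 (iv)** — L2-t3's named `Prop` `Thm37_iv` ("If `D` is slim, and `Λ ∈ {ℤ, ℝ}`, then `C` is
also slim") — from the inputs of `isSlim_category_of`. [cite: MochizukiEtTh2009, Thm 3.7 p.80] -/
theorem thm37_iv_of (hF : PreFrobenioid.IsFrobenioid C₀.toElem) (hB : ∀ (Y : D₀ᵒᵖ) (b : T.BΛ.obj Y), IsUnit b)
    (hqft : PreFrobenioid.IsOfType (PreFrobenioid.IsQuasiFrobeniusTrivial C₀.toElem))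
    (hdiv : ∀ (X : C₀.category) (α : Aut X), α ∈ PreFrobenioid.unitsSubgroup C₀.toElem X →
      (∀ n : ℕ+, ∃ β : Aut X, β ∈ PreFrobenioid.unitsSubgroup C₀.toElem X ∧ β ^ (n : ℕ) = α) → α = 1) :
    C₀.Thm37_iv :=
  fun hD _ => C₀.isSlim_category_of hF hB hqft hdiv hD

end TemperedFrobenioid

end Literature.AnabelianGeometry.EtaleTheta
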